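import Mathlib
import HarnessLib
import Literature.RepresentationTheory.AlgebraicGroups.FormsCoeffAction
import Literature.RepresentationTheory.AlgebraicGroups.UnitaryZariskiDense

/-!
# Weyl's unitarian trick for invariants of forms: `SU(σ)`-invariance implies `SL(σ, ℂ)`-invariance

Let `G` be a polynomial in the coefficients of forms of degree `m` in the variables `σ`
(coordinates `(σ →₀ ℕ) → ℂ`, action `A ◇ v = coeffVec (linSubst σ ℂ A (∑ d ∈ degMonomials σ m,
monomial d (v d)))` of all matrices `A`, file `FormsCoeffAction`). If `G` is homogeneous and
invariant under the special unitary group, `G(U ◇ v) = G(v)` for all `U ∈ SU(σ)`, then `G` is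
invariant under `SL(σ, ℂ)` (`aeval_act_eq_of_specialUnitaryGroup_invariant`).

Proof. Let `n = |σ|`, `G` homogeneous of degree `j`. The scalar matrices `ζ · 1`, `ζⁿ = 1`, lie in
`SU(σ)` and act on `V_m` by `ζ^m`, so `ζ^{mj} G = G`; hence either `G` vanishes identically (if
`n ∤ mj`) or `mj = ne`. In the latter case, for `U ∈ U(σ)` write `U = λ K` with `λⁿ = det U`,
`K ∈ SU(σ)`: then `G(U ◇ v) = λ^{mj} G(K ◇ v) = (det U)^e G(v)`. Both sides are polynomials in
the entries of `U` (`eval_aeval_genericCoeff`), so the identity `G(A ◇ v) = (det A)^e G(v)`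
holds for every matrix `A` by Zariski density of `U(σ)` (`mvPolynomial_eq_zero_of_eval_unitaryGroup`,
file `UnitaryZariskiDense`), in particular `G(g ◇ v) = G(v)` when `det g = 1`.

References: H. Weyl, *The Classical Groups* (1939), Ch. VIII §11; Goodman–Wallach, GTM 255,
§3.3.4 and Thm. 11.5.10; Mumford–Fogarty–Kirwan, GIT, Ch. 1 §1 (char. 0: `SL` is linearly
reductive). All statements here are proved.
-/

noncomputable section

open MvPolynomial Matrix
open Literature.Computability.AlgebraicComplexity

namespace Literature.RepresentationTheory.AlgebraicGroups

variable {σ : Type*} [Fintype σ] [DecidableEq σ] (m : ℕ)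

/-- Scalar matrices `ζ • 1` with `ζⁿ = 1`, `n = |σ| ≠ 0`, lie in `SU(σ)`. [folklore] -/
theorem smul_one_mem_specialUnitaryGroup {ζ : ℂ} (hζ : ζ ^ Fintype.card σ = 1)
    (hn : Fintype.card σ ≠ 0) : ζ • (1 : Matrix σ σ ℂ) ∈ Matrix.specialUnitaryGroup σ ℂ := by
  have hnorm : ‖ζ‖ = 1 := Complex.norm_eq_one_of_pow_eq_one hζ hn
  rw [Matrix.mem_specialUnitaryGroup_iff, Matrix.mem_unitaryGroup_iff]
  refine ⟨?_, by rw [det_smul, det_one, mul_one, hζ]⟩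
  rw [star_smul, star_one, Matrix.smul_mul, Matrix.mul_smul, one_mul, smul_smul]
  have : ζ * star ζ = 1 := by
    rw [Complex.star_def, Complex.mul_conj, Complex.normSq_eq_norm_sq, hnorm]
    simp
  rw [this, one_smul]

/-- A unitary matrix is `λ • K` with `K ∈ SU(σ)` and `λⁿ = det U` (`n = |σ| ≠ 0`): take any
`n`-th root `λ` of `det U`; it has modulus one. [folklore] -/
theorem exists_smul_mem_specialUnitaryGroup_of_mem_unitaryGroup {U : Matrix σ σ ℂ}
    (hU : U ∈ Matrix.unitaryGroup σ ℂ) (hn : Fintype.card σ ≠ 0) :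
    ∃ (c : ℂ) (K : Matrix σ σ ℂ), K ∈ Matrix.specialUnitaryGroup σ ℂ ∧
      c ^ Fintype.card σ = U.det ∧ U = c • K := by
  obtain ⟨c, hc⟩ := IsAlgClosed.exists_pow_nat_eq U.det (Nat.pos_of_ne_zero hn)
  have hdet : ‖U.det‖ = 1 := CStarRing.norm_coe_unitary ⟨U.det, Matrix.det_of_mem_unitary hU⟩
  have hcn : ‖c‖ = 1 := by
    have h : ‖c‖ ^ Fintype.card σ = 1 := by rw [← norm_pow, hc, hdet]
    exact (pow_eq_one_iff_of_nonneg (norm_nonneg c) hn).1 h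
  have hc0 : c ≠ 0 := fun h => by simp [h] at hcn
  refine ⟨c, c⁻¹ • U, ?_, hc, by rw [smul_smul, mul_inv_cancel₀ hc0, one_smul]⟩
  rw [Matrix.mem_specialUnitaryGroup_iff, Matrix.mem_unitaryGroup_iff]
  constructor
  · rw [star_smul, Matrix.smul_mul, Matrix.mul_smul, smul_smul, Matrix.mem_unitaryGroup_iff.1 hU]
    have : c⁻¹ * star c⁻¹ = 1 := by
      rw [Complex.star_def, map_inv₀, ← mul_inv, Complex.mul_conj, Complex.normSq_eq_norm_sq, hcn]
      simp
    rw [this, one_smul]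
  · rw [det_smul, inv_pow, hc, inv_mul_cancel₀]
    rw [← norm_ne_zero_iff, hdet]
    exact one_ne_zero

/-- **Weyl's unitarian trick for invariants of forms.** A polynomial in the coefficients of
degree-`m` forms which is homogeneous and `SU(σ)`-invariant is `SL(σ, ℂ)`-invariant:
`G(g ◇ v) = G(v)` whenever `det g = 1`. (Weyl 1939 Ch. VIII §11; Goodman–Wallach GTM 255
§3.3.4 with Thm. 11.5.10; this is the statement that makes the Haar average over `SU(σ)` a
Reynolds operator for `SL(σ, ℂ)`, Mumford–Fogarty–Kirwan Ch. 1 §1.)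
[cite: GoodmanWallachGTM255, §3.3.4 and Thm. 11.5.10] -/
theorem aeval_act_eq_of_specialUnitaryGroup_invariant (G : MvPolynomial (σ →₀ ℕ) ℂ) {j : ℕ}
    (hG : G.IsHomogeneous j)
    (hinv : ∀ U : Matrix σ σ ℂ, U ∈ Matrix.specialUnitaryGroup σ ℂ → ∀ v : (σ →₀ ℕ) → ℂ,
      aeval (coeffVec (linSubst σ ℂ U (∑ d ∈ degMonomials σ m, monomial d (v d)))) G =
        aeval v G)
    (g : Matrix σ σ ℂ) (hg : g.det = 1) (v : (σ →₀ ℕ) → ℂ) :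
    aeval (coeffVec (linSubst σ ℂ g (∑ d ∈ degMonomials σ m, monomial d (v d)))) G =
      aeval v G := by
  classical
  rcases isEmpty_or_nonempty σ with hσ | hσ
  · have h1 : g = 1 := Subsingleton.elim _ _
    rw [h1]
    exact hinv 1 (one_mem _) v
  set n := Fintype.card σ with hn_def
  have hn : n ≠ 0 := Fintype.card_ne_zero
  -- Step a: roots of unity
  have hroot : ∀ ζ : ℂ, ζ ^ n = 1 → ∀ w : (σ →₀ ℕ) → ℂ, ζ ^ (m * j) * aeval w G = aeval w G := by
    intro ζ hζ w
    have h1 := hinv _ (smul_one_mem_specialUnitaryGroup hζ hn) w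
    have h2 := hinv 1 (one_mem _) w
    rw [act_smul, aeval_eq_eval, eval_smul_of_isHomogeneous hG, ← aeval_eq_eval, h2,
      ← pow_mul] at h1
    exact h1
  by_cases hdvd : n ∣ m * j
  swap
  · -- `G` vanishes identically
    have hζ := Complex.isPrimitiveRoot_exp n hn
    have hne : Complex.exp (2 * Real.pi * Complex.I / n) ^ (m * j) ≠ 1 :=
      fun h => hdvd ((hζ.pow_eq_one_iff_dvd _).1 h)
    have hzero : ∀ w : (σ →₀ ℕ) → ℂ, aeval w G = 0 := fun w => by
      have := hroot _ hζ.pow_eq_one w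
      have : (Complex.exp (2 * Real.pi * Complex.I / n) ^ (m * j) - 1) * aeval w G = 0 := by
        rw [sub_mul, one_mul, this, sub_self]
      exact (mul_eq_zero.1 this).resolve_left (sub_ne_zero.2 hne)
    rw [hzero, hzero]
  obtain ⟨e, he⟩ := hdvd
  -- Step c: the twisted identity on `U(σ)`
  have hU : ∀ U : Matrix σ σ ℂ, U ∈ Matrix.unitaryGroup σ ℂ → ∀ w : (σ →₀ ℕ) → ℂ,
      aeval (coeffVec (linSubst σ ℂ U (∑ d ∈ degMonomials σ m, monomial d (w d)))) G =
        U.det ^ e * aeval w G := by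
    intro U hUm w
    obtain ⟨c, K, hK, hc, rfl⟩ := exists_smul_mem_specialUnitaryGroup_of_mem_unitaryGroup hUm hn
    rw [act_smul, aeval_eq_eval, eval_smul_of_isHomogeneous hG, ← aeval_eq_eval, hinv K hK w,
      ← pow_mul, he, pow_mul, hc]
  -- both sides are polynomials in the entries of `U`: extend to all matrices
  set P : MvPolynomial (σ × σ) ℂ :=
    aeval (fun d : σ →₀ ℕ => ∑ d' ∈ degMonomials σ m, v d' • coeff d
      (linSubst σ (MvPolynomial (σ × σ) ℂ) (Matrix.mvPolynomialX σ σ ℂ) (monomial d' 1))) G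
    with hP
  set Q : MvPolynomial (σ × σ) ℂ := (Matrix.mvPolynomialX σ σ ℂ).det ^ e * C (aeval v G) with hQ
  have hPQ : ∀ A : Matrix σ σ ℂ, eval (fun p : σ × σ => A p.1 p.2) P =
      aeval (coeffVec (linSubst σ ℂ A (∑ d ∈ degMonomials σ m, monomial d (v d)))) G :=
    fun A => eval_aeval_genericCoeff m G A v
  have hQA : ∀ A : Matrix σ σ ℂ, eval (fun p : σ × σ => A p.1 p.2) Q = A.det ^ e * aeval v G := by
    intro A
    have hofA : (Matrix.of fun i j => (fun p : σ × σ => A p.1 p.2) (i, j)) = A := by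
      ext i j
      simp
    rw [hQ, map_mul, map_pow, eval_C, Matrix.eval_det_mvPolynomialX, hofA]
  have key := eval_eq_of_eval_eq_on_unitaryGroup P Q (fun U hUm => by rw [hPQ, hQA, hU U hUm]) g
  rw [hPQ, hQA, hg, one_pow, one_mul] at key
  exact key

end Literature.RepresentationTheory.AlgebraicGroups

end
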